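import Summits.BirchSwinnertonDyer.Rank1Residual.GaloisImage.SakamotoN11Instance
import HarnessLib

/-!
# The reduction map `red : E[p^{k′+1}] → E[p^{k+1}]`, `x ↦ p^{k′−k} x`, between the torsion levels
# of the N11 chain — a constructor for the binders `(red, hred)` of the R1-23 END THEOREM
# (cell `b2b-bsdres`, team n1011, ROUTE-1 §27.2 ledger entry "`red k′, hred` T … S adapter if no
# constructor is on file"; seat p11 gen 4; ON CALL item while row T-HCC-adm is complete)

HONEST FRAMING (cell `b2b-bsdres`, run/shared/lean/b2b/bsd-rank1-residual/, verbatim in every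
file): the goal of the cell is to DELETE the COMBINATION-SHAPED residual classes of the
Birch–Swinnerton-Dyer formula for ALL analytic-rank `≤ 1` elliptic curves over `ℚ` — "full BSD
formula for every rank `≤ 1` curve in class `C`" assembled STRICTLY from published theorems — so
that the rank-`≤ 1` remainder becomes exactly the CONSTRUCTION-SHAPED classes, which are TYPED
(missing-input `Prop`s), NOT attempted. This is not "finishing BSD". Team n1011 (N10 / N11, the
additive block X4 ∧ `p = 3`): research route; TOOL theorems only (no definition, no named fact,
no `sorry`); nothing is booked; no mark / label moved.

## What

n1011-p18's END THEOREM `Assembly.padicValRat_le_of_certificate_of_transport` (p271924) and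
n1011-p09's two-level dictionary `KatoKuriharaDictionaryThreeAt₂` (p263491) quantify over a family
`red k′ : E[3^{k′}·3] →ⁱL E[3^k·3]` with `hred : ∀ x, red x = 3^{k′−k} • x` (on underlying points).
This file CONSTRUCTS it for every `k, k′` (route planner 1's instance ledger, ROUTE-1 §27.2:
"S adapter if no constructor is on file"): for `k ≤ k′` the composite of the tree's inclusion
`E[p^{k′}·p] ↪ E[p^{k′−k}·(p^k·p)]` (`torsionInclusion`, the two levels are EQUAL) with
multiplication by `p^{k′−k}` (`torsionMulBy`); for `k′ < k` (where `k′ − k = 0` in `ℕ`) the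
inclusion `E[p^{k′}·p] ↪ E[p^k·p]`.

* `exists_torsionReduction_pow_mul` — `∃ red, ∀ x, (red x : geomPoints W) = (p : ℤ)^(k′−k) • x`,
  for every prime `p` and all `k, k′`;
* `exists_torsionReduction_three` — the `p = 3` reading in the spelling of the N11 files.

References: B. Mazur, K. Rubin, Mem. AMS 799 (2004) App. A (the maps `T/m^{k′} → T/m^k`);
J. S. Milne, *Arithmetic Duality Theorems* I §6 (the maps `A_{m²} → A_m`).
-/

noncomputable section

open scoped Classical NumberField ContRepresentation
open Field NumberField WeierstrassCurve Literature.NumberTheory.EllipticCurves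

namespace Summit.BirchSwinnertonDyer.Rank1Residual.GaloisImage

variable {K : Type} [Field K] (W : WeierstrassCurve K)

/-- **The reduction map between torsion levels**: for a prime `p` (any natural number, in fact) and
all `k, k′` there is a continuous `Γ_K`-intertwining map `red : E[p^{k′}·p] → E[p^k·p]` acting on
points as multiplication by `p^{k′−k}` (truncated subtraction: the inclusion when `k′ ≤ k`).
[folklore] -/
theorem exists_torsionReduction_pow_mul (p k k' : ℕ) :
    ∃ red : (W.torsionGaloisModule (((p : ℕ) : ℤ) ^ k' * ((p : ℕ) : ℤ))).toContRepresentation →ⁱL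
        (W.torsionGaloisModule (((p : ℕ) : ℤ) ^ k * ((p : ℕ) : ℤ))).toContRepresentation,
      ∀ x : geomTorsion W (((p : ℕ) : ℤ) ^ k' * ((p : ℕ) : ℤ)),
        ((red x : geomTorsion W (((p : ℕ) : ℤ) ^ k * ((p : ℕ) : ℤ))) : geomPoints W) =
          (((p : ℕ) : ℤ) ^ (k' - k)) • (x : geomPoints W) := by
  rcases le_or_gt k k' with hk | hk
  · -- `k ≤ k′`: inclusion into the equal level `p^{k′−k}·(p^k·p)`, then multiplication
    have hdvd : ((p : ℕ) : ℤ) ^ k' * ((p : ℕ) : ℤ) ∣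
        ((p : ℕ) : ℤ) ^ (k' - k) * (((p : ℕ) : ℤ) ^ k * ((p : ℕ) : ℤ)) :=
      dvd_of_eq (by rw [← mul_assoc, ← pow_add, Nat.sub_add_cancel hk])
    refine ⟨(W.torsionMulBy (((p : ℕ) : ℤ) ^ (k' - k)) (((p : ℕ) : ℤ) ^ k * ((p : ℕ) : ℤ))).comp
      (W.torsionInclusion hdvd), fun x => ?_⟩
    rfl
  · -- `k′ < k`: `k′ − k = 0`, the inclusion `E[p^{k′}·p] ↪ E[p^k·p]`
    have hdvd : ((p : ℕ) : ℤ) ^ k' * ((p : ℕ) : ℤ) ∣ ((p : ℕ) : ℤ) ^ k * ((p : ℕ) : ℤ) :=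
      mul_dvd_mul_right (pow_dvd_pow _ hk.le) _
    refine ⟨W.torsionInclusion hdvd, fun x => ?_⟩
    rw [Nat.sub_eq_zero_of_le hk.le, pow_zero, one_smul]
    rfl

/-- **The `p = 3` reading** (the `(red, hred)` binders of `Assembly.padicValRat_le_of_certificate_of_transport`
and of `KatoKuriharaDictionaryThreeAt₂`, for every `k, k′`). [folklore] -/
theorem exists_torsionReduction_three (k k' : ℕ) :
    ∃ red : (W.torsionGaloisModule (((3 : ℕ) : ℤ) ^ k' * ((3 : ℕ) : ℤ))).toContRepresentation →ⁱL
        (W.torsionGaloisModule (((3 : ℕ) : ℤ) ^ k * ((3 : ℕ) : ℤ))).toContRepresentation,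
      ∀ x : geomTorsion W (((3 : ℕ) : ℤ) ^ k' * ((3 : ℕ) : ℤ)),
        ((red x : geomTorsion W (((3 : ℕ) : ℤ) ^ k * ((3 : ℕ) : ℤ))) : geomPoints W) =
          (((3 : ℕ) : ℤ) ^ (k' - k)) • (x : geomPoints W) :=
  exists_torsionReduction_pow_mul W 3 k k'

end Summit.BirchSwinnertonDyer.Rank1Residual.GaloisImage

end
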